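import Literature.AlgebraicGeometry.Hu2025.Proofs.S03Pluecker.GammaQuadSliceCoords
import HarnessLib

/-!
# Hu 2025 / [Hu22] Thm 9.4 «`U ⊂ X × 𝔸^r` open … `U ≅ Gr̄_d`» for `d = quad`: the torus quotient IS AN OPEN OF `𝔸⁶` —
# the ring isomorphism `Rh ⧸ J ≅ k[y₁, …, y₆][1/Δ]` (joint J1 / GAP-LEDGER-HU row HU-R01, reading (β); the `r_pos` item of
# row 110 h — kernel support, OURS)

**HONEST FRAMING (D-0012/D-0089).** [Hu2025] (arXiv:2507.21400v1) and [Hu2022] (arXiv:2203.03842v4) are unrefereed preprints under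
adjudication; nothing of them is asserted. OURS objects only (sequel of `GammaQuadSliceCoords.lean`; typed carriers of rows 101/110).

Row 110 h (`Hu22Setup_printed_ours`, res-type-024) carries Thm 9.4's «there exists a positive integer `r` and an open subset
`U ⊂ X × 𝔸^r` … such that `U` is isomorphic to the quotient space `Gr̄_d := Gr_d/(𝔾ⁿ_m/𝔾_m)`» ([Hu22] p.130 l.45–50) as `r_pos` with
`U : (𝔸(Fin r; X)).Opens`. For the quad family the quotient is the normal-form slice `Spec (Rh ⧸ J)` (`GammaQuadTorus`); THIS FILE
shows it is an OPEN SUBSCHEME OF `𝔸⁶` at ring level: with the free slice coordinates `y = (b₅, c₅, b₆, b₇, c₇, b₈)` and the explicit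
polynomial columns `p_a(y)` (`p₆, p₈` cleared by `y₀ − 1`, `y₃ − 1`; `p₉ = det(p₅,p₇,p₈) p₆ − det(p₅,p₇,p₆) p₈`),
* `Δ6 = (y₀−1)(y₃−1) · p₉(y)₀ · ∏_{u ∉ Γ} det(p_{u₁}, p_{u₂}, p_{u₃})` and `B6 k = k[y][1/Δ6]`;
* `G : Rh ⧸ J → B6` = evaluation of the chart at the normal-form matrix `N(y)` (columns `p_a/d_a`), `F : B6 → Rh ⧸ J` = `y ↦`
  slice coordinates; `F ∘ N = n` (`F_N`), `G (n_{a,i}) = N_{a,i}` (`G_nv`);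
* **`sliceRationalEquiv : Slice k ≃+* B6 k`** (`G ∘ F = id`, `F ∘ G = id`).
Hence `Gr̄_quad = Spec (Rh ⧸ J) ≅ D(Δ6) ⊂ 𝔸⁶_k` — the remaining ring-level input for an inhabitant of row 110 h with `X := Spec k`,
`r := 6` (res-type-024's recipe, `SplitTorusOverAPI` p528603). AI proof is weaker than expert review.
-/

noncomputable section

namespace Literature.AlgebraicGeometry.Hu2025.Statements.S03Pluecker

open MvPolynomial Matrix

namespace QuadTorus

open QuadCell

variable (k : Type) [Field k]

/-! ## The polynomial model: columns `p_a(y)` over `k[y₀, …, y₅]` -/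

/-- `k[y₀, …, y₅]` (`y = (b₅, c₅, b₆, b₇, c₇, b₈)`). OURS.
[cite: Hu2025, Thm. 9.4 («an open subset U ⊂ X × 𝔸^r … isomorphic to Gr̄_d») p.161; [Hu22] p.130 l.45–50; joint J1 = GAP-LEDGER-HU row HU-R01 (unrefereed preprints under adjudication, D-0012/D-0089 — kernel support on OUR typed carriers of rows 101/110; nothing of the sources asserted)] -/
abbrev P6 : Type := MvPolynomial (Fin 6) k

/-- `p₄ = (1,1,1)`. OURS.
[cite: Hu2025, Thm. 9.4 p.161; joint J1 = GAP-LEDGER-HU row HU-R01 (unrefereed preprints under adjudication, D-0012/D-0089 — kernel support on OUR typed carriers of rows 101/110; nothing of the sources asserted)] -/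
def p4 : Fin 3 → P6 k := ![1, 1, 1]
/-- `p₅ = (1, y₀, y₁)`. OURS.
[cite: Hu2025, Thm. 9.4 p.161; joint J1 = GAP-LEDGER-HU row HU-R01 (unrefereed preprints under adjudication, D-0012/D-0089 — kernel support on OUR typed carriers of rows 101/110; nothing of the sources asserted)] -/
def p5 : Fin 3 → P6 k := ![1, X 0, X 1]
/-- `p₆ = (y₀ − 1)·n₆ = (y₀ − 1, (y₀ − 1) y₂, (y₀ − 1) + (y₁ − 1)(y₂ − 1))` (cleared). OURS.
[cite: Hu2025, Thm. 9.4 p.161; joint J1 = GAP-LEDGER-HU row HU-R01 (unrefereed preprints under adjudication, D-0012/D-0089 — kernel support on OUR typed carriers of rows 101/110; nothing of the sources asserted)] -/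
def p6 : Fin 3 → P6 k := ![X 0 - 1, (X 0 - 1) * X 2, (X 0 - 1) + (X 1 - 1) * (X 2 - 1)]
/-- `p₇ = (1, y₃, y₄)`. OURS.
[cite: Hu2025, Thm. 9.4 p.161; joint J1 = GAP-LEDGER-HU row HU-R01 (unrefereed preprints under adjudication, D-0012/D-0089 — kernel support on OUR typed carriers of rows 101/110; nothing of the sources asserted)] -/
def p7 : Fin 3 → P6 k := ![1, X 3, X 4]
/-- `p₈ = (y₃ − 1)·n₈` (cleared). OURS.
[cite: Hu2025, Thm. 9.4 p.161; joint J1 = GAP-LEDGER-HU row HU-R01 (unrefereed preprints under adjudication, D-0012/D-0089 — kernel support on OUR typed carriers of rows 101/110; nothing of the sources asserted)] -/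
def p8 : Fin 3 → P6 k := ![X 3 - 1, (X 3 - 1) * X 5, (X 3 - 1) + (X 4 - 1) * (X 5 - 1)]
/-- `p₉ = det(p₅,p₇,p₈)·p₆ − det(p₅,p₇,p₆)·p₈` (the intersection of the lines `p₅p₇`, `p₆p₈`, cleared). OURS.
[cite: Hu2025, Thm. 9.4 p.161; joint J1 = GAP-LEDGER-HU row HU-R01 (unrefereed preprints under adjudication, D-0012/D-0089 — kernel support on OUR typed carriers of rows 101/110; nothing of the sources asserted)] -/
def p9 : Fin 3 → P6 k := det3 (p5 k) (p7 k) (p8 k) • p6 k + (-det3 (p5 k) (p7 k) (p6 k)) • p8 k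

/-- The polynomial columns `p_a(y)`, `a = 1..9`. OURS.
[cite: Hu2025, Thm. 9.4 p.161; joint J1 = GAP-LEDGER-HU row HU-R01 (unrefereed preprints under adjudication, D-0012/D-0089 — kernel support on OUR typed carriers of rows 101/110; nothing of the sources asserted)] -/
def pc (a : ℕ) : Fin 3 → P6 k :=
  if a = 1 then ![1, 0, 0] else if a = 2 then ![0, 1, 0] else if a = 3 then ![0, 0, 1]
  else if a = 4 then p4 k else if a = 5 then p5 k else if a = 6 then p6 k else if a = 7 then p7 k
  else if a = 8 then p8 k else if a = 9 then p9 k else 0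

/-- The values of `pc`.
[cite: Hu2025, Thm. 9.4 p.161; joint J1 = GAP-LEDGER-HU row HU-R01 (unrefereed preprints under adjudication, D-0012/D-0089 — kernel support on OUR typed carriers of rows 101/110; nothing of the sources asserted)] -/
theorem pc_val : pc k 1 = ![1, 0, 0] ∧ pc k 2 = ![0, 1, 0] ∧ pc k 3 = ![0, 0, 1] ∧ pc k 4 = p4 k ∧ pc k 5 = p5 k ∧
    pc k 6 = p6 k ∧ pc k 7 = p7 k ∧ pc k 8 = p8 k ∧ pc k 9 = p9 k := by
  simp [pc]

/-- The `u`-minor of the polynomial columns. OURS.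
[cite: Hu2025, Thm. 9.4 p.161; joint J1 = GAP-LEDGER-HU row HU-R01 (unrefereed preprints under adjudication, D-0012/D-0089 — kernel support on OUR typed carriers of rows 101/110; nothing of the sources asserted)] -/
def minorP6 (u : ℕ × ℕ × ℕ) : P6 k := det3 (pc k u.1) (pc k u.2.1) (pc k u.2.2)

/-- The clearing denominators `d_a(y)`: `y₀ − 1` (`a = 6`), `y₃ − 1` (`a = 8`), `p₉(y)₀` (`a = 9`), else `1`. OURS.
[cite: Hu2025, Thm. 9.4 p.161; joint J1 = GAP-LEDGER-HU row HU-R01 (unrefereed preprints under adjudication, D-0012/D-0089 — kernel support on OUR typed carriers of rows 101/110; nothing of the sources asserted)] -/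
def dpoly (a : ℕ) : P6 k := if a = 6 then X 0 - 1 else if a = 8 then X 3 - 1 else if a = 9 then p9 k 0 else 1

/-- The values of `d_a`.
[cite: Hu2025, Thm. 9.4 p.161; joint J1 = GAP-LEDGER-HU row HU-R01 (unrefereed preprints under adjudication, D-0012/D-0089 — kernel support on OUR typed carriers of rows 101/110; nothing of the sources asserted)] -/
theorem dpoly_vals : dpoly k 6 = X 0 - 1 ∧ dpoly k 8 = X 3 - 1 ∧ dpoly k 9 = p9 k 0 ∧
    ∀ a, a ≠ 6 → a ≠ 8 → a ≠ 9 → dpoly k a = 1 := by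
  refine ⟨by simp [dpoly], by simp [dpoly], by simp [dpoly], fun a h6 h8 h9 => ?_⟩
  unfold dpoly; rw [if_neg h6, if_neg h8, if_neg h9]

/-- **`Δ6 = (y₀−1)(y₃−1) · p₉(y)₀ · ∏_{u ∉ Γ} minor_u(y)`** — the element inverted on `𝔸⁶`. OURS.
[cite: Hu2025, Thm. 9.4 («an open subset U ⊂ X × 𝔸^r») p.161; joint J1 = GAP-LEDGER-HU row HU-R01 (unrefereed preprints under adjudication, D-0012/D-0089 — kernel support on OUR typed carriers of rows 101/110; nothing of the sources asserted)] -/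
def Δ6 : P6 k := (X 0 - 1) * (X 3 - 1) * p9 k 0 * ∏ u ∈ offGamma, minorP6 k u

/-- **`B6 k = k[y₀..y₅][1/Δ6]`** — the coordinate ring of the open `D(Δ6) ⊂ 𝔸⁶`. OURS.
[cite: Hu2025, Thm. 9.4 («an open subset U ⊂ X × 𝔸^r … isomorphic to Gr̄_d») p.161; joint J1 = GAP-LEDGER-HU row HU-R01 (unrefereed preprints under adjudication, D-0012/D-0089 — kernel support on OUR typed carriers of rows 101/110; nothing of the sources asserted)] -/
abbrev B6 : Type := Localization.Away (Δ6 k)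

/-- `det` with a repeated column vanishes.
[cite: Hu2025, Thm. 9.4 p.161; joint J1 = GAP-LEDGER-HU row HU-R01 (unrefereed preprints under adjudication, D-0012/D-0089 — kernel support on OUR typed carriers of rows 101/110; nothing of the sources asserted)] -/
theorem det3_self {R : Type*} [CommRing R] (v w : Fin 3 → R) : det3 v w v = 0 ∧ det3 v w w = 0 := by
  constructor <;> (simp only [det3_eq]; ring)

/-- Scaling each column: `det3 (c₁v) (c₂w) (c₃x) = c₁c₂c₃ det3 v w x`.
[cite: Hu2025, Thm. 9.4 p.161; joint J1 = GAP-LEDGER-HU row HU-R01 (unrefereed preprints under adjudication, D-0012/D-0089 — kernel support on OUR typed carriers of rows 101/110; nothing of the sources asserted)] -/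
theorem det3_scale3 {R : Type*} [CommRing R] (c₁ c₂ c₃ : R) (v w x : Fin 3 → R) :
    det3 (fun i => c₁ * v i) (fun i => c₂ * w i) (fun i => c₃ * x i) = c₁ * c₂ * c₃ * det3 v w x := by
  simp only [det3_eq]; ring

/-- **The four Γ-minors of the polynomial model vanish** (by construction of `p₆, p₈, p₉`).
[cite: Hu2025, Def. 7.1 (Z_Γ) p.128 / (9.3) Γ_d / Thm. 9.4 p.161; joint J1 = GAP-LEDGER-HU row HU-R01 (unrefereed preprints under adjudication, D-0012/D-0089 — kernel support on OUR typed carriers of rows 101/110; nothing of the sources asserted)] -/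
theorem minorP6_gamma : ∀ u ∈ quadGamma, minorP6 k u = 0 := by
  obtain ⟨-, -, -, c4, c5, c6, c7, c8, c9⟩ := pc_val k
  intro u hu
  simp only [quadGamma, Set.mem_insert_iff, Set.mem_singleton_iff] at hu
  rcases hu with rfl | rfl | rfl | rfl
  · simp only [minorP6, c4, c5, c6, p4, p5, p6, det3_eq, Matrix.cons_val_zero, Matrix.cons_val_one, Matrix.cons_val_two,
      Matrix.tail_cons, Matrix.head_cons]
    ring
  · simp only [minorP6, c4, c7, c8, p4, p7, p8, det3_eq, Matrix.cons_val_zero, Matrix.cons_val_one, Matrix.cons_val_two,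
      Matrix.tail_cons, Matrix.head_cons]
    ring
  · show det3 (p5 k) (p7 k) (p9 k) = 0
    rw [p9, det3_add_smul]
    ring
  · show det3 (p6 k) (p8 k) (p9 k) = 0
    rw [p9, det3_add_smul, (det3_self _ _).1, (det3_self _ _).2]
    ring

/-! ## Units of `B6` and the matrix `N(y)` -/

/-- `d_a ∣ Δ6` for every `a`, and `minor_u ∣ Δ6` for `u ∉ Γ`.
[cite: Hu2025, Thm. 9.4 p.161; joint J1 = GAP-LEDGER-HU row HU-R01 (unrefereed preprints under adjudication, D-0012/D-0089 — kernel support on OUR typed carriers of rows 101/110; nothing of the sources asserted)] -/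
theorem dvd_Δ6 : (∀ a, dpoly k a ∣ Δ6 k) ∧ ∀ u ∈ offGamma, minorP6 k u ∣ Δ6 k := by
  refine ⟨fun a => ?_, fun u hu => by
    unfold Δ6
    exact (Finset.dvd_prod_of_mem (fun v => minorP6 k v) hu).mul_left _⟩
  unfold dpoly Δ6
  split_ifs
  · exact ⟨(X 3 - 1) * p9 k 0 * ∏ u ∈ offGamma, minorP6 k u, by ring⟩
  · exact ⟨(X 0 - 1) * p9 k 0 * ∏ u ∈ offGamma, minorP6 k u, by ring⟩
  · exact ⟨(X 0 - 1) * (X 3 - 1) * ∏ u ∈ offGamma, minorP6 k u, by ring⟩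
  · exact one_dvd _

/-- Divisors of `Δ6` become units in `B6`.
[cite: Hu2025, Thm. 9.4 p.161; joint J1 = GAP-LEDGER-HU row HU-R01 (unrefereed preprints under adjudication, D-0012/D-0089 — kernel support on OUR typed carriers of rows 101/110; nothing of the sources asserted)] -/
theorem isUnit_of_dvd_Δ6 {f : P6 k} (h : f ∣ Δ6 k) : IsUnit (algebraMap (P6 k) (B6 k) f) :=
  isUnit_of_dvd_unit (map_dvd _ h) (IsLocalization.Away.algebraMap_isUnit (Δ6 k))

/-- `c_a := (d_a)⁻¹ ∈ B6`. OURS plumbing.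
[cite: Hu2025, Thm. 9.4 p.161; joint J1 = GAP-LEDGER-HU row HU-R01 (unrefereed preprints under adjudication, D-0012/D-0089 — kernel support on OUR typed carriers of rows 101/110; nothing of the sources asserted)] -/
def cB (a : ℕ) : B6 k := ((isUnit_of_dvd_Δ6 k ((dvd_Δ6 k).1 a)).unit⁻¹ : (B6 k)ˣ)

/-- `d_a · c_a = 1`.
[cite: Hu2025, Thm. 9.4 p.161; joint J1 = GAP-LEDGER-HU row HU-R01 (unrefereed preprints under adjudication, D-0012/D-0089 — kernel support on OUR typed carriers of rows 101/110; nothing of the sources asserted)] -/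
theorem dpoly_mul_cB (a : ℕ) : algebraMap (P6 k) (B6 k) (dpoly k a) * cB k a = 1 := by
  rw [cB]; exact (isUnit_of_dvd_Δ6 k ((dvd_Δ6 k).1 a)).mul_val_inv

/-- `c_a = 1` off `{6, 8, 9}`.
[cite: Hu2025, Thm. 9.4 p.161; joint J1 = GAP-LEDGER-HU row HU-R01 (unrefereed preprints under adjudication, D-0012/D-0089 — kernel support on OUR typed carriers of rows 101/110; nothing of the sources asserted)] -/
theorem cB_eq_one {a : ℕ} (h6 : a ≠ 6) (h8 : a ≠ 8) (h9 : a ≠ 9) : cB k a = 1 := by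
  have h := dpoly_mul_cB k a
  have hd : dpoly k a = 1 := by unfold dpoly; rw [if_neg h6, if_neg h8, if_neg h9]
  rwa [hd, map_one, one_mul] at h

/-- **The normal-form matrix `N(y)` over `B6`**: columns `N_a = p_a(y)/d_a(y)`. OURS.
[cite: Hu2025, Thm. 9.4 («U is isomorphic to the quotient space Gr̄_d») p.161; [Hu22] p.131 l.6–16; joint J1 = GAP-LEDGER-HU row HU-R01 (unrefereed preprints under adjudication, D-0012/D-0089 — kernel support on OUR typed carriers of rows 101/110; nothing of the sources asserted)] -/
def N (a : ℕ) : Fin 3 → B6 k := fun i => cB k a * algebraMap (P6 k) (B6 k) (pc k a i)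

/-- The frame columns of `N(y)`.
[cite: Hu2025, Prop. 3.6 ([I₃ | A]) p.38; joint J1 = GAP-LEDGER-HU row HU-R01 (unrefereed preprints under adjudication, D-0012/D-0089 — kernel support on OUR typed carriers of rows 101/110; nothing of the sources asserted)] -/
theorem N_frame : N k 1 = ![1, 0, 0] ∧ N k 2 = ![0, 1, 0] ∧ N k 3 = ![0, 0, 1] := by
  obtain ⟨c1, c2, c3, -⟩ := pc_val k
  have e1 := cB_eq_one k (a := 1) (by norm_num) (by norm_num) (by norm_num)
  have e2 := cB_eq_one k (a := 2) (by norm_num) (by norm_num) (by norm_num)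
  have e3 := cB_eq_one k (a := 3) (by norm_num) (by norm_num) (by norm_num)
  refine ⟨?_, ?_, ?_⟩
  · funext i; simp only [N, c1, e1]; fin_cases i <;> simp
  · funext i; simp only [N, c2, e2]; fin_cases i <;> simp
  · funext i; simp only [N, c3, e3]; fin_cases i <;> simp

/-- **The minor `det(N_{u₁}, N_{u₂}, N_{u₃}) = c_{u₁}c_{u₂}c_{u₃} · minor_u(y)`**.
[cite: Hu2025, Thm. 9.4 p.161 / Prop. 3.6 p.38; joint J1 = GAP-LEDGER-HU row HU-R01 (unrefereed preprints under adjudication, D-0012/D-0089 — kernel support on OUR typed carriers of rows 101/110; nothing of the sources asserted)] -/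
theorem det3_N (u : ℕ × ℕ × ℕ) :
    det3 (N k u.1) (N k u.2.1) (N k u.2.2) = cB k u.1 * cB k u.2.1 * cB k u.2.2 * algebraMap (P6 k) (B6 k) (minorP6 k u) := by
  rw [minorP6, map_det3]
  exact det3_scale3 _ _ _ _ _ _

/-- The Γ-minors of `N(y)` vanish.
[cite: Hu2025, Def. 7.1 (Z_Γ) p.128 / Thm. 9.4 p.161; joint J1 = GAP-LEDGER-HU row HU-R01 (unrefereed preprints under adjudication, D-0012/D-0089 — kernel support on OUR typed carriers of rows 101/110; nothing of the sources asserted)] -/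
theorem det3_N_gamma {u : ℕ × ℕ × ℕ} (hu : u ∈ quadGamma) : det3 (N k u.1) (N k u.2.1) (N k u.2.2) = 0 := by
  rw [det3_N, minorP6_gamma k u hu, map_zero, mul_zero]

/-- The non-Γ minors of `N(y)` are units.
[cite: Hu2025, Prop. 9.1 (Gr_d: «p_u ≠ 0, ∀ x_u ∈ Δ_d») p.160 / Thm. 9.4 p.161; joint J1 = GAP-LEDGER-HU row HU-R01 (unrefereed preprints under adjudication, D-0012/D-0089 — kernel support on OUR typed carriers of rows 101/110; nothing of the sources asserted)] -/
theorem isUnit_det3_N {u : ℕ × ℕ × ℕ} (hu : u ∈ offGamma) : IsUnit (det3 (N k u.1) (N k u.2.1) (N k u.2.2)) := by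
  rw [det3_N]
  have hc : ∀ a, IsUnit (cB k a) := fun a => by rw [cB]; exact Units.isUnit _
  exact (((hc _).mul (hc _)).mul (hc _)).mul (isUnit_of_dvd_Δ6 k ((dvd_Δ6 k).2 u hu))

/-! ## `G : Rh ⧸ J → B6` — evaluating the chart at `N(y)` -/

/-- The value of the basic variable `x_t` at `N(y)` (matching `chartCol`). OURS plumbing.
[cite: Hu2025, Prop. 3.6 (k[Var_𝕌]) p.38 / Thm. 9.4 p.161; joint J1 = GAP-LEDGER-HU row HU-R01 (unrefereed preprints under adjudication, D-0012/D-0089 — kernel support on OUR typed carriers of rows 101/110; nothing of the sources asserted)] -/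
def bvalG (t : ℕ × ℕ × ℕ) : B6 k :=
  if t.1 = 2 then N k t.2.2 0 else if t.2.1 = 3 then -N k t.2.2 1 else N k t.2.2 2

/-- `ψG : k[Var_𝕌] → B6`, the basic variables evaluated at `N(y)`. OURS.
[cite: Hu2025, Prop. 3.6 p.38 / Thm. 9.4 p.161; joint J1 = GAP-LEDGER-HU row HU-R01 (unrefereed preprints under adjudication, D-0012/D-0089 — kernel support on OUR typed carriers of rows 101/110; nothing of the sources asserted)] -/
def ψG : BasicRing 9 k →ₐ[k] B6 k := MvPolynomial.aeval fun x => bvalG k x.1.1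

/-- `ψG` on a basic variable.
[cite: Hu2025, Prop. 3.6 p.38; joint J1 = GAP-LEDGER-HU row HU-R01 (unrefereed preprints under adjudication, D-0012/D-0089 — kernel support on OUR typed carriers of rows 101/110; nothing of the sources asserted)] -/
theorem ψG_bvar {t : ℕ × ℕ × ℕ} (h : t ∈ plVarSet 9) (hb : ¬ IsLt t) : ψG k (bvar k t) = bvalG k t := by
  rw [bvar_of_mem k h hb, ψG, MvPolynomial.aeval_X]

/-- `ψG ∘ chartCol a = N_a` for `1 ≤ a ≤ 9`.
[cite: Hu2025, Prop. 3.6 p.38 / Thm. 9.4 p.161; joint J1 = GAP-LEDGER-HU row HU-R01 (unrefereed preprints under adjudication, D-0012/D-0089 — kernel support on OUR typed carriers of rows 101/110; nothing of the sources asserted)] -/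
theorem ψG_chartCol {a : ℕ} (ha1 : 1 ≤ a) (ha9 : a ≤ 9) : (ψG k) ∘ chartCol k a = N k a := by
  by_cases ha : 3 < a
  · have h23 : ((2, 3, a) : ℕ × ℕ × ℕ) ∈ plVarSet 9 := mem_plVarSet (by norm_num) (by norm_num) ha ha9 ha
    have h13 : ((1, 3, a) : ℕ × ℕ × ℕ) ∈ plVarSet 9 := mem_plVarSet (by norm_num) (by norm_num) ha ha9 ha
    have h12 : ((1, 2, a) : ℕ × ℕ × ℕ) ∈ plVarSet 9 := mem_plVarSet (by norm_num) (by norm_num) (by omega) ha9 ha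
    have n23 : ¬ IsLt ((2, 3, a) : ℕ × ℕ × ℕ) := not_isLt_of_le (by norm_num) (by norm_num) le_rfl
    have n13 : ¬ IsLt ((1, 3, a) : ℕ × ℕ × ℕ) := not_isLt_of_le (by norm_num) (by norm_num) le_rfl
    have n12 : ¬ IsLt ((1, 2, a) : ℕ × ℕ × ℕ) := not_isLt_of_le (by norm_num) (by norm_num) (by norm_num)
    rw [chartCol_of_lt k ha]
    refine vec3_eq ?_ ?_ ?_
    · simp [ψG_bvar k h23 n23, bvalG]
    · simp [ψG_bvar k h13 n13, bvalG]
    · simp [ψG_bvar k h12 n12, bvalG]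
  · obtain ⟨f1, f2, f3⟩ := N_frame k
    have ha' : a = 1 ∨ a = 2 ∨ a = 3 := by omega
    rcases ha' with rfl | rfl | rfl
    · rw [chartCol_one, f1]; refine vec3_eq ?_ ?_ ?_ <;> simp [ψG]
    · rw [chartCol_two, f2]; refine vec3_eq ?_ ?_ ?_ <;> simp [ψG]
    · rw [chartCol_three, f3]; refine vec3_eq ?_ ?_ ?_ <;> simp [ψG]

/-- `ψG (chartMinor u) = det(N_{u₁}, N_{u₂}, N_{u₃})` for `u ∈ 𝕀_{3,9}`.
[cite: Hu2025, Prop. 3.6 p.38 / Thm. 9.4 p.161; joint J1 = GAP-LEDGER-HU row HU-R01 (unrefereed preprints under adjudication, D-0012/D-0089 — kernel support on OUR typed carriers of rows 101/110; nothing of the sources asserted)] -/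
theorem ψG_chartMinor {u : ℕ × ℕ × ℕ} (hu : u ∈ plIndexSet 9) :
    ψG k (chartMinor k u) = det3 (N k u.1) (N k u.2.1) (N k u.2.2) := by
  have hidx := mem_plIndexSet_iff.mp hu
  have h := map_det3 (ψG k).toRingHom (chartCol k u.1) (chartCol k u.2.1) (chartCol k u.2.2)
  rw [AlgHom.toRingHom_eq_coe, RingHom.coe_coe] at h
  rw [chartMinor]
  erw [h]
  rw [ψG_chartCol k (a := u.1) (by omega) (by omega), ψG_chartCol k (a := u.2.1) (by omega) (by omega),
    ψG_chartCol k (a := u.2.2) (by omega) (by omega)]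

/-- `φG : k[x_u] → B6` (`= ψG ∘ chartParam`). OURS.
[cite: Hu2025, Prop. 3.6 p.38 / Thm. 9.4 p.161; joint J1 = GAP-LEDGER-HU row HU-R01 (unrefereed preprints under adjudication, D-0012/D-0089 — kernel support on OUR typed carriers of rows 101/110; nothing of the sources asserted)] -/
def φG : ChartRing 9 k →ₐ[k] B6 k := (ψG k).comp (chartParam 9 k)

/-- `φG (x̄_u) = det(N_u)` for chart indices.
[cite: Hu2025, Prop. 3.6 p.38 / Thm. 9.4 p.161; joint J1 = GAP-LEDGER-HU row HU-R01 (unrefereed preprints under adjudication, D-0012/D-0089 — kernel support on OUR typed carriers of rows 101/110; nothing of the sources asserted)] -/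
theorem φG_xbar {u : ℕ × ℕ × ℕ} (hu : u ∈ plVarSet 9) : φG k (xbar k u) = det3 (N k u.1) (N k u.2.1) (N k u.2.2) := by
  rw [φG, AlgHom.comp_apply, chartParam_xbar k hu, ψG_chartMinor k (Finset.mem_erase.mp hu).2]

/-- `φG` kills the Γ-scheme ideal (`N(y)` is a point of the cell's closure `Z_Γ`).
[cite: Hu2025, Def. 7.1 (I_{℘,Γ}) p.128 / Prop. 3.6 p.38; joint J1 = GAP-LEDGER-HU row HU-R01 (unrefereed preprints under adjudication, D-0012/D-0089 — kernel support on OUR typed carriers of rows 101/110; nothing of the sources asserted)] -/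
theorem φG_gammaChartIdeal : ∀ F' ∈ gammaChartIdeal k 9 quadGamma, φG k F' = 0 := by
  intro F' hF
  rw [mem_gammaChartIdeal_iff k (quadGamma_subset le_rfl)] at hF
  have hle : gammaMinorIdeal k 9 quadGamma ≤ RingHom.ker (ψG k).toRingHom := by
    unfold gammaMinorIdeal
    rw [Ideal.span_le]
    rintro _ ⟨u, hu, rfl⟩
    rw [SetLike.mem_coe, RingHom.mem_ker, AlgHom.toRingHom_eq_coe, RingHom.coe_coe,
      ψG_chartMinor k (Finset.mem_erase.mp (quadGamma_subset le_rfl hu)).2]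
    exact det3_N_gamma k hu
  have := hle hF
  rw [RingHom.mem_ker, AlgHom.toRingHom_eq_coe, RingHom.coe_coe] at this
  rw [φG, AlgHom.comp_apply]
  exact this

/-- `ΦGq : Rq → B6`. OURS.
[cite: Hu2025, Def. 7.1 (Z_Γ) p.128 / Thm. 9.4 p.161; joint J1 = GAP-LEDGER-HU row HU-R01 (unrefereed preprints under adjudication, D-0012/D-0089 — kernel support on OUR typed carriers of rows 101/110; nothing of the sources asserted)] -/
def ΦGq : Rq k →+* B6 k :=
  Ideal.Quotient.lift (gammaChartIdeal k 9 quadGamma) (φG k).toRingHom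
    (fun F' hF => by rw [AlgHom.toRingHom_eq_coe, RingHom.coe_coe]; exact φG_gammaChartIdeal k F' hF)

/-- `ΦGq (hq)` is a unit.
[cite: Hu2025, Prop. 9.1 (Gr_d) p.160 / Thm. 9.4 p.161; joint J1 = GAP-LEDGER-HU row HU-R01 (unrefereed preprints under adjudication, D-0012/D-0089 — kernel support on OUR typed carriers of rows 101/110; nothing of the sources asserted)] -/
theorem isUnit_ΦGq_hq : IsUnit (ΦGq k (hq k)) := by
  show IsUnit (ΦGq k (Ideal.Quotient.mk _ (hprod k)))
  rw [ΦGq, Ideal.Quotient.lift_mk, AlgHom.toRingHom_eq_coe, RingHom.coe_coe, hprod, map_prod, IsUnit.prod_iff]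
  intro u hu
  rw [φG_xbar k (Finset.mem_filter.mp hu).1]
  exact isUnit_det3_N k hu

/-- **`ΦGh : Rh → B6`** — the `B6`-valued point `N(y)` of the cell. OURS.
[cite: Hu2025, Prop. 9.1 (Gr_d) p.160 / Thm. 9.4 p.161; joint J1 = GAP-LEDGER-HU row HU-R01 (unrefereed preprints under adjudication, D-0012/D-0089 — kernel support on OUR typed carriers of rows 101/110; nothing of the sources asserted)] -/
def ΦGh : Rh k →+* B6 k := IsLocalization.Away.lift (hq k) (isUnit_ΦGq_hq k)

/-- `ΦGh (toRh F) = φG F`.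
[cite: Hu2025, Thm. 9.4 p.161; joint J1 = GAP-LEDGER-HU row HU-R01 (unrefereed preprints under adjudication, D-0012/D-0089 — kernel support on OUR typed carriers of rows 101/110; nothing of the sources asserted)] -/
theorem ΦGh_toRh (F' : ChartRing 9 k) : ΦGh k (toRh k F') = φG k F' := by
  rw [toRh, RingHom.comp_apply, ΦGh, IsLocalization.Away.lift_eq, ΦGq, Ideal.Quotient.lift_mk, AlgHom.toRingHom_eq_coe,
    RingHom.coe_coe]

/-- `ΦGh (m u) = det(N_u)` for chart indices.
[cite: Hu2025, Thm. 9.4 p.161; joint J1 = GAP-LEDGER-HU row HU-R01 (unrefereed preprints under adjudication, D-0012/D-0089 — kernel support on OUR typed carriers of rows 101/110; nothing of the sources asserted)] -/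
theorem ΦGh_m {u : ℕ × ℕ × ℕ} (hu : u ∈ plVarSet 9) : ΦGh k (m k u) = det3 (N k u.1) (N k u.2.1) (N k u.2.2) := by
  rw [m, ΦGh_toRh, φG_xbar k hu]

/-- **`ΦGh (A_{a,i}) = N(y)_{a,i}`** (`1 ≤ a ≤ 9`).
[cite: Hu2025, Thm. 9.4 p.161 / Prop. 3.6 p.38; joint J1 = GAP-LEDGER-HU row HU-R01 (unrefereed preprints under adjudication, D-0012/D-0089 — kernel support on OUR typed carriers of rows 101/110; nothing of the sources asserted)] -/
theorem ΦGh_A {a : ℕ} (ha1 : 1 ≤ a) (ha9 : a ≤ 9) (i : Fin 3) : ΦGh k (A k a i) = N k a i := by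
  have h := congrFun (ψG_chartCol k ha1 ha9) i
  rw [Function.comp_apply] at h
  rw [A, Function.comp_apply, Function.comp_apply, ΦGh_toRh, φG, AlgHom.comp_apply, chartParam_basicIncl, h]

/-- `ΦGh` on constants.
[cite: Hu2025, Thm. 9.4 p.161; joint J1 = GAP-LEDGER-HU row HU-R01 (unrefereed preprints under adjudication, D-0012/D-0089 — kernel support on OUR typed carriers of rows 101/110; nothing of the sources asserted)] -/
theorem ΦGh_toRh_C (c : k) : ΦGh k (toRh k (C c)) = algebraMap (P6 k) (B6 k) (C c) := by
  rw [ΦGh_toRh, ← MvPolynomial.algebraMap_eq, AlgHom.commutes, ← MvPolynomial.algebraMap_eq,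
    ← IsScalarTower.algebraMap_apply]

/-- **`N(y)` is in normal form**: `N_{a,0} = 1` (`4 ≤ a ≤ 9`) and `N_{4,i} = 1`.
[cite: Hu2025, Thm. 9.4 («Gr̄_d := Gr_d/(𝔾ⁿ_m/𝔾_m)») p.161; [Hu22] p.131 l.6–16; joint J1 = GAP-LEDGER-HU row HU-R01 (unrefereed preprints under adjudication, D-0012/D-0089 — kernel support on OUR typed carriers of rows 101/110; nothing of the sources asserted)] -/
theorem N_normal : (∀ a, 3 < a → a ≤ 9 → N k a 0 = 1) ∧ ∀ i, N k 4 i = 1 := by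
  obtain ⟨-, -, -, c4, c5, c6, c7, c8, c9⟩ := pc_val k
  have e4 := cB_eq_one k (a := 4) (by norm_num) (by norm_num) (by norm_num)
  have e5 := cB_eq_one k (a := 5) (by norm_num) (by norm_num) (by norm_num)
  have e7 := cB_eq_one k (a := 7) (by norm_num) (by norm_num) (by norm_num)
  obtain ⟨v6, v8, v9, -⟩ := dpoly_vals k
  have d6 := dpoly_mul_cB k 6
  have d8 := dpoly_mul_cB k 8
  have d9 := dpoly_mul_cB k 9
  rw [v6] at d6
  rw [v8] at d8
  rw [v9] at d9
  refine ⟨fun a ha ha9 => ?_, fun i => ?_⟩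
  · have : a = 4 ∨ a = 5 ∨ a = 6 ∨ a = 7 ∨ a = 8 ∨ a = 9 := by omega
    rcases this with rfl | rfl | rfl | rfl | rfl | rfl
    · simp [N, c4, p4, e4]
    · simp [N, c5, p5, e5]
    · rw [N, c6, p6, Matrix.cons_val_zero, mul_comm]; exact d6
    · simp [N, c7, p7, e7]
    · rw [N, c8, p8, Matrix.cons_val_zero, mul_comm]; exact d8
    · rw [N, c9, mul_comm]; exact d9
  · fin_cases i <;> simp [N, c4, p4, e4]

/-- `ΦGh` kills the slice ideal `J`.
[cite: Hu2025, Thm. 9.4 p.161; [Hu22] p.131 l.6–16; joint J1 = GAP-LEDGER-HU row HU-R01 (unrefereed preprints under adjudication, D-0012/D-0089 — kernel support on OUR typed carriers of rows 101/110; nothing of the sources asserted)] -/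
theorem ΦGh_J : ∀ x ∈ J k, ΦGh k x = 0 := by
  obtain ⟨n0, n4⟩ := N_normal k
  have hle : J k ≤ RingHom.ker (ΦGh k) := by
    unfold J
    rw [Ideal.span_le]
    intro x hx
    simp only [Set.mem_insert_iff, Set.mem_singleton_iff] at hx
    rw [SetLike.mem_coe, RingHom.mem_ker]
    rcases hx with rfl | rfl | rfl | rfl | rfl | rfl | rfl | rfl
    all_goals rw [map_sub, map_one, sub_eq_zero, ΦGh_A k (by norm_num) (by norm_num)]
    · exact n0 4 (by norm_num) (by norm_num)
    · exact n0 5 (by norm_num) (by norm_num)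
    · exact n0 6 (by norm_num) (by norm_num)
    · exact n0 7 (by norm_num) (by norm_num)
    · exact n0 8 (by norm_num) (by norm_num)
    · exact n0 9 (by norm_num) (by norm_num)
    · exact n4 1
    · exact n4 2
  intro x hx
  exact RingHom.mem_ker.mp (hle hx)

/-- **`G : Rh ⧸ J → B6`** — the slice functions as rational functions on `𝔸⁶`. OURS.
[cite: Hu2025, Thm. 9.4 («an open subset U ⊂ X × 𝔸^r … isomorphic to Gr̄_d») p.161; [Hu22] p.130 l.45–50; joint J1 = GAP-LEDGER-HU row HU-R01 (unrefereed preprints under adjudication, D-0012/D-0089 — kernel support on OUR typed carriers of rows 101/110; nothing of the sources asserted)] -/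
def G : Slice k →+* B6 k := Ideal.Quotient.lift (J k) (ΦGh k) (ΦGh_J k)

/-- `G (n_{a,i}) = N(y)_{a,i}`.
[cite: Hu2025, Thm. 9.4 p.161; joint J1 = GAP-LEDGER-HU row HU-R01 (unrefereed preprints under adjudication, D-0012/D-0089 — kernel support on OUR typed carriers of rows 101/110; nothing of the sources asserted)] -/
theorem G_nv {a : ℕ} (ha1 : 1 ≤ a) (ha9 : a ≤ 9) (i : Fin 3) : G k (nv k a i) = N k a i := by
  rw [nv, G]
  show Ideal.Quotient.lift (J k) (ΦGh k) (ΦGh_J k) (Ideal.Quotient.mk (J k) (A k a i)) = N k a i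
  rw [Ideal.Quotient.lift_mk, ΦGh_A k ha1 ha9]

/-! ## `F : B6 → Rh ⧸ J` — the six free coordinates -/

/-- The six free slice coordinates `(b₅, c₅, b₆, b₇, c₇, b₈)`. OURS.
[cite: Hu2025, Thm. 9.4 p.161; [Hu22] p.131 l.6–16; joint J1 = GAP-LEDGER-HU row HU-R01 (unrefereed preprints under adjudication, D-0012/D-0089 — kernel support on OUR typed carriers of rows 101/110; nothing of the sources asserted)] -/
def ys : Fin 6 → Slice k := ![bq k 5, cq k 5, bq k 6, bq k 7, cq k 7, bq k 8]

/-- `F₀ : k[y] → Rh ⧸ J`, `yⱼ ↦` the free coordinates. OURS.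
[cite: Hu2025, Thm. 9.4 p.161; joint J1 = GAP-LEDGER-HU row HU-R01 (unrefereed preprints under adjudication, D-0012/D-0089 — kernel support on OUR typed carriers of rows 101/110; nothing of the sources asserted)] -/
def F₀ : P6 k →ₐ[k] Slice k := MvPolynomial.aeval (ys k)

/-- The values of `F₀` on the variables.
[cite: Hu2025, Thm. 9.4 p.161; joint J1 = GAP-LEDGER-HU row HU-R01 (unrefereed preprints under adjudication, D-0012/D-0089 — kernel support on OUR typed carriers of rows 101/110; nothing of the sources asserted)] -/
theorem F₀_X : F₀ k (X 0) = bq k 5 ∧ F₀ k (X 1) = cq k 5 ∧ F₀ k (X 2) = bq k 6 ∧ F₀ k (X 3) = bq k 7 ∧ F₀ k (X 4) = cq k 7 ∧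
    F₀ k (X 5) = bq k 8 := by
  simp [F₀, ys]

/-- The images of the clearing denominators: `dF a := F₀ (d_a)`. OURS plumbing.
[cite: Hu2025, Thm. 9.4 p.161; joint J1 = GAP-LEDGER-HU row HU-R01 (unrefereed preprints under adjudication, D-0012/D-0089 — kernel support on OUR typed carriers of rows 101/110; nothing of the sources asserted)] -/
def dF (a : ℕ) : Slice k := F₀ k (dpoly k a)

/-- First row of the normal form on the slice: `n_{a,0} = 1` (`3 < a ≤ 9`).
[cite: Hu2025, Thm. 9.4 p.161; [Hu22] p.131 l.6–16; joint J1 = GAP-LEDGER-HU row HU-R01 (unrefereed preprints under adjudication, D-0012/D-0089 — kernel support on OUR typed carriers of rows 101/110; nothing of the sources asserted)] -/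
theorem nv_row0 {a : ℕ} (ha : 3 < a) (ha9 : a ≤ 9) : nv k a 0 = 1 := (mk_A_eq_one k).1 a ha ha9

/-- `F₀ ∘ p₅ = n₅`, `F₀ ∘ p₇ = n₇`.
[cite: Hu2025, Thm. 9.4 p.161; joint J1 = GAP-LEDGER-HU row HU-R01 (unrefereed preprints under adjudication, D-0012/D-0089 — kernel support on OUR typed carriers of rows 101/110; nothing of the sources asserted)] -/
theorem F₀_p57 : (F₀ k) ∘ p5 k = nv k 5 ∧ (F₀ k) ∘ p7 k = nv k 7 := by
  obtain ⟨x0, x1, x2, x3, x4, x5⟩ := F₀_X k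
  constructor
  · rw [nv_eq k (by norm_num) (by norm_num)]; refine vec3_eq ?_ ?_ ?_ <;> simp [p5, x0, x1]
  · rw [nv_eq k (by norm_num) (by norm_num)]; refine vec3_eq ?_ ?_ ?_ <;> simp [p7, x3, x4]

/-- `F₀ ∘ p₆ = (b₅ − 1)·n₆`, `F₀ ∘ p₈ = (b₇ − 1)·n₈` (elimination of `c₆, c₈`).
[cite: Hu2025, Thm. 9.4 p.161 / Def. 7.1 p.128; joint J1 = GAP-LEDGER-HU row HU-R01 (unrefereed preprints under adjudication, D-0012/D-0089 — kernel support on OUR typed carriers of rows 101/110; nothing of the sources asserted)] -/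
theorem F₀_p68 : ((F₀ k) ∘ p6 k = fun i => (bq k 5 - 1) * nv k 6 i) ∧ ((F₀ k) ∘ p8 k = fun i => (bq k 7 - 1) * nv k 8 i) := by
  obtain ⟨x0, x1, x2, x3, x4, x5⟩ := F₀_X k
  obtain ⟨k6, k8⟩ := c6_c8_cleared k
  constructor
  · rw [nv_eq k (by norm_num) (by norm_num)]
    refine vec3_eq ?_ ?_ ?_
    · simp [p6, x0]
    · simp [p6, x0, x2, bq]
    · simp only [Function.comp_apply, p6, Matrix.cons_val_two, Matrix.tail_cons, Matrix.head_cons, map_add, map_sub,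
        map_mul, map_one, x0, x1, x2]
      exact k6.symm
  · rw [nv_eq k (by norm_num) (by norm_num)]
    refine vec3_eq ?_ ?_ ?_
    · simp [p8, x3]
    · simp [p8, x3, x5, bq]
    · simp only [Function.comp_apply, p8, Matrix.cons_val_two, Matrix.tail_cons, Matrix.head_cons, map_add, map_sub,
        map_mul, map_one, x3, x4, x5]
      exact k8.symm

/-- `F₀ (det(p₅,p₇,p₈)) = (b₇ − 1) x̄₅₇₈` and `F₀ (det(p₅,p₇,p₆)) = −(b₅ − 1) x̄₅₆₇`.
[cite: Hu2025, Thm. 9.4 p.161 / Prop. 9.1 p.160; joint J1 = GAP-LEDGER-HU row HU-R01 (unrefereed preprints under adjudication, D-0012/D-0089 — kernel support on OUR typed carriers of rows 101/110; nothing of the sources asserted)] -/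
theorem F₀_αβ : F₀ k (det3 (p5 k) (p7 k) (p8 k)) = (bq k 7 - 1) * ms k (5, 7, 8) ∧
    F₀ k (det3 (p5 k) (p7 k) (p6 k)) = -((bq k 5 - 1) * ms k (5, 6, 7)) := by
  obtain ⟨h5, h7⟩ := F₀_p57 k
  obtain ⟨h6, h8⟩ := F₀_p68 k
  constructor
  · have := map_det3 (F₀ k).toRingHom (p5 k) (p7 k) (p8 k)
    rw [AlgHom.toRingHom_eq_coe, RingHom.coe_coe] at this
    rw [this]
    erw [h5, h7, h8]
    rw [ms_eq_det3 k (mem9 (by norm_num) (by norm_num) (by norm_num) (by norm_num) (by norm_num))]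
    simp only [det3_eq]; ring
  · have := map_det3 (F₀ k).toRingHom (p5 k) (p7 k) (p6 k)
    rw [AlgHom.toRingHom_eq_coe, RingHom.coe_coe] at this
    rw [this]
    erw [h5, h7, h6]
    rw [ms_eq_det3 k (mem9 (by norm_num) (by norm_num) (by norm_num) (by norm_num) (by norm_num))]
    simp only [det3_eq]; ring

/-- `dF 6 = b₅ − 1`, `dF 8 = b₇ − 1`, `dF 9 = (b₅ − 1)(b₇ − 1) w`, `dF a = 1` otherwise.
[cite: Hu2025, Thm. 9.4 p.161; joint J1 = GAP-LEDGER-HU row HU-R01 (unrefereed preprints under adjudication, D-0012/D-0089 — kernel support on OUR typed carriers of rows 101/110; nothing of the sources asserted)] -/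
theorem dF_vals : dF k 6 = bq k 5 - 1 ∧ dF k 8 = bq k 7 - 1 ∧ dF k 9 = (bq k 5 - 1) * (bq k 7 - 1) * w k ∧
    ∀ a, a ≠ 6 → a ≠ 8 → a ≠ 9 → dF k a = 1 := by
  obtain ⟨x0, x1, x2, x3, x4, x5⟩ := F₀_X k
  obtain ⟨hα, hβ⟩ := F₀_αβ k
  obtain ⟨h6, h8⟩ := F₀_p68 k
  obtain ⟨v6, v8, v9, v1⟩ := dpoly_vals k
  refine ⟨?_, ?_, ?_, fun a a6 a8 a9 => ?_⟩
  · rw [dF, v6, map_sub, x0, map_one]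
  · rw [dF, v8, map_sub, x3, map_one]
  · rw [dF, v9, p9, Pi.add_apply, Pi.smul_apply, Pi.smul_apply, smul_eq_mul, smul_eq_mul, map_add, map_mul, map_mul, map_neg,
      hα, hβ, neg_neg, w]
    have e6 : F₀ k (p6 k 0) = (bq k 5 - 1) * nv k 6 0 := congrFun h6 0
    have e8 : F₀ k (p8 k 0) = (bq k 7 - 1) * nv k 8 0 := congrFun h8 0
    rw [e6, e8, nv_row0 k (by norm_num) (by norm_num), nv_row0 k (by norm_num) (by norm_num)]
    ring
  · rw [dF, v1 a a6 a8 a9, map_one]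

/-- `F₀ ∘ p₉ = (b₅ − 1)(b₇ − 1) w · n₉` (Cramer for `n₉`).
[cite: Hu2025, Thm. 9.4 p.161 / Def. 7.1 p.128; joint J1 = GAP-LEDGER-HU row HU-R01 (unrefereed preprints under adjudication, D-0012/D-0089 — kernel support on OUR typed carriers of rows 101/110; nothing of the sources asserted)] -/
theorem F₀_p9 : (F₀ k) ∘ p9 k = fun i => dF k 9 * nv k 9 i := by
  obtain ⟨hα, hβ⟩ := F₀_αβ k
  obtain ⟨h6, h8⟩ := F₀_p68 k
  obtain ⟨cr1, cr2⟩ := cramer9 k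
  obtain ⟨-, -, d9, -⟩ := dF_vals k
  rw [d9, nv_eq k (by norm_num) (by norm_num)]
  have key : ∀ i, F₀ k (p9 k i) = (bq k 7 - 1) * ms k (5, 7, 8) * ((bq k 5 - 1) * nv k 6 i) +
      (bq k 5 - 1) * ms k (5, 6, 7) * ((bq k 7 - 1) * nv k 8 i) := by
    intro i
    rw [p9, Pi.add_apply, Pi.smul_apply, Pi.smul_apply, smul_eq_mul, smul_eq_mul, map_add, map_mul, map_mul, map_neg, hα, hβ,
      neg_neg]
    rw [show F₀ k (p6 k i) = (bq k 5 - 1) * nv k 6 i from congrFun h6 i,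
      show F₀ k (p8 k i) = (bq k 7 - 1) * nv k 8 i from congrFun h8 i]
  refine vec3_eq ?_ ?_ ?_
  · rw [Function.comp_apply, key, nv_row0 k (by norm_num) (by norm_num), nv_row0 k (by norm_num) (by norm_num)]
    simp only [Matrix.cons_val_zero, w]; ring
  · rw [Function.comp_apply, key]
    simp only [Matrix.cons_val_one, Matrix.cons_val_zero]
    rw [show nv k 6 1 = bq k 6 from rfl, show nv k 8 1 = bq k 8 from rfl]
    linear_combination -((bq k 5 - 1) * (bq k 7 - 1)) * cr1
  · rw [Function.comp_apply, key]
    simp only [Matrix.cons_val_two, Matrix.tail_cons, Matrix.head_cons]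
    rw [show nv k 6 2 = cq k 6 from rfl, show nv k 8 2 = cq k 8 from rfl]
    linear_combination -((bq k 5 - 1) * (bq k 7 - 1)) * cr2

/-- **`F₀ (p_a(y)) = d_a · n_a`** — the column identities (`1 ≤ a ≤ 9`).
[cite: Hu2025, Thm. 9.4 p.161; [Hu22] p.131 l.6–16; joint J1 = GAP-LEDGER-HU row HU-R01 (unrefereed preprints under adjudication, D-0012/D-0089 — kernel support on OUR typed carriers of rows 101/110; nothing of the sources asserted)] -/
theorem F₀_pc {a : ℕ} (ha1 : 1 ≤ a) (ha9 : a ≤ 9) : (F₀ k) ∘ pc k a = fun i => dF k a * nv k a i := by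
  obtain ⟨c1, c2, c3, c4, c5, c6, c7, c8, c9⟩ := pc_val k
  obtain ⟨f1, f2, f3⟩ := nv_frame k
  obtain ⟨h5, h7⟩ := F₀_p57 k
  obtain ⟨h6, h8⟩ := F₀_p68 k
  obtain ⟨d6, d8, -, d1⟩ := dF_vals k
  have : a = 1 ∨ a = 2 ∨ a = 3 ∨ a = 4 ∨ a = 5 ∨ a = 6 ∨ a = 7 ∨ a = 8 ∨ a = 9 := by omega
  rcases this with rfl | rfl | rfl | rfl | rfl | rfl | rfl | rfl | rfl
  · rw [c1, f1, d1 1 (by norm_num) (by norm_num) (by norm_num)]; refine vec3_eq ?_ ?_ ?_ <;> simp [F₀]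
  · rw [c2, f2, d1 2 (by norm_num) (by norm_num) (by norm_num)]; refine vec3_eq ?_ ?_ ?_ <;> simp [F₀]
  · rw [c3, f3, d1 3 (by norm_num) (by norm_num) (by norm_num)]; refine vec3_eq ?_ ?_ ?_ <;> simp [F₀]
  · rw [c4, nv_four, d1 4 (by norm_num) (by norm_num) (by norm_num)]; refine vec3_eq ?_ ?_ ?_ <;> simp [p4, F₀]
  · rw [c5, h5, d1 5 (by norm_num) (by norm_num) (by norm_num)]; funext i; rw [one_mul]
  · rw [c6, h6, d6]
  · rw [c7, h7, d1 7 (by norm_num) (by norm_num) (by norm_num)]; funext i; rw [one_mul]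
  · rw [c8, h8, d8]
  · rw [c9]; exact F₀_p9 k

/-- The `dF a` are units.
[cite: Hu2025, Prop. 9.1 (Gr_d) p.160 / Thm. 9.4 p.161; joint J1 = GAP-LEDGER-HU row HU-R01 (unrefereed preprints under adjudication, D-0012/D-0089 — kernel support on OUR typed carriers of rows 101/110; nothing of the sources asserted)] -/
theorem isUnit_dF (a : ℕ) : IsUnit (dF k a) := by
  obtain ⟨u5, u7, -⟩ := units_b k
  obtain ⟨d6, d8, d9, d1⟩ := dF_vals k
  by_cases a6 : a = 6
  · subst a6; rw [d6]; exact u5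
  by_cases a8 : a = 8
  · subst a8; rw [d8]; exact u7
  by_cases a9 : a = 9
  · subst a9; rw [d9]; exact (u5.mul u7).mul (isUnit_w k)
  rw [d1 a a6 a8 a9]; exact isUnit_one

/-- `F₀ (minor_u(y)) = dF_{u₁} dF_{u₂} dF_{u₃} · x̄_u` for chart indices `u`.
[cite: Hu2025, Prop. 9.1 (Gr_d) p.160 / Thm. 9.4 p.161; joint J1 = GAP-LEDGER-HU row HU-R01 (unrefereed preprints under adjudication, D-0012/D-0089 — kernel support on OUR typed carriers of rows 101/110; nothing of the sources asserted)] -/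
theorem F₀_minorP6 {u : ℕ × ℕ × ℕ} (hu : u ∈ plVarSet 9) :
    F₀ k (minorP6 k u) = dF k u.1 * dF k u.2.1 * dF k u.2.2 * ms k u := by
  have hidx := mem_plIndexSet_iff.mp (Finset.mem_erase.mp hu).2
  have h := map_det3 (F₀ k).toRingHom (pc k u.1) (pc k u.2.1) (pc k u.2.2)
  rw [AlgHom.toRingHom_eq_coe, RingHom.coe_coe] at h
  rw [minorP6, h]
  erw [F₀_pc k (a := u.1) (by omega) (by omega), F₀_pc k (a := u.2.1) (by omega) (by omega),
    F₀_pc k (a := u.2.2) (by omega) (by omega)]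
  rw [det3_scale3, ms_eq_det3 k hu]

/-- `F₀ (Δ6)` is a unit of the slice ring.
[cite: Hu2025, Prop. 9.1 (Gr_d) p.160 / Thm. 9.4 p.161; joint J1 = GAP-LEDGER-HU row HU-R01 (unrefereed preprints under adjudication, D-0012/D-0089 — kernel support on OUR typed carriers of rows 101/110; nothing of the sources asserted)] -/
theorem isUnit_F₀_Δ6 : IsUnit (F₀ k (Δ6 k)) := by
  obtain ⟨d6, d8, d9, -⟩ := dF_vals k
  obtain ⟨v6, v8, v9, -⟩ := dpoly_vals k
  have h6 := isUnit_dF k 6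
  have h8 := isUnit_dF k 8
  have h9 := isUnit_dF k 9
  rw [dF, v6] at h6
  rw [dF, v8] at h8
  rw [dF, v9] at h9
  rw [Δ6, map_mul, map_mul, map_mul, map_prod]
  refine ((h6.mul h8).mul h9).mul ?_
  rw [IsUnit.prod_iff]
  intro u hu
  rw [F₀_minorP6 k (Finset.mem_filter.mp hu).1]
  exact (((isUnit_dF k _).mul (isUnit_dF k _)).mul (isUnit_dF k _)).mul (isUnit_ms k hu)

/-- **`F : B6 → Rh ⧸ J`**. OURS.
[cite: Hu2025, Thm. 9.4 («an open subset U ⊂ X × 𝔸^r … isomorphic to Gr̄_d») p.161; joint J1 = GAP-LEDGER-HU row HU-R01 (unrefereed preprints under adjudication, D-0012/D-0089 — kernel support on OUR typed carriers of rows 101/110; nothing of the sources asserted)] -/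
def F : B6 k →+* Slice k := IsLocalization.Away.lift (Δ6 k) (g := (F₀ k).toRingHom) (isUnit_F₀_Δ6 k)

/-- `F` on polynomials.
[cite: Hu2025, Thm. 9.4 p.161; joint J1 = GAP-LEDGER-HU row HU-R01 (unrefereed preprints under adjudication, D-0012/D-0089 — kernel support on OUR typed carriers of rows 101/110; nothing of the sources asserted)] -/
theorem F_algebraMap (p : P6 k) : F k (algebraMap (P6 k) (B6 k) p) = F₀ k p :=
  IsLocalization.Away.lift_eq _ _ p

/-- `dF a · F (c_a) = 1`.
[cite: Hu2025, Thm. 9.4 p.161; joint J1 = GAP-LEDGER-HU row HU-R01 (unrefereed preprints under adjudication, D-0012/D-0089 — kernel support on OUR typed carriers of rows 101/110; nothing of the sources asserted)] -/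
theorem F_cB_mul (a : ℕ) : dF k a * F k (cB k a) = 1 := by
  have h := congrArg (F k) (dpoly_mul_cB k a)
  rwa [map_mul, map_one, F_algebraMap] at h

/-- **`F ∘ N(y) = n`**: the free coordinates evaluated back give the normal form (`1 ≤ a ≤ 9`).
[cite: Hu2025, Thm. 9.4 p.161; [Hu22] p.131 l.6–16; joint J1 = GAP-LEDGER-HU row HU-R01 (unrefereed preprints under adjudication, D-0012/D-0089 — kernel support on OUR typed carriers of rows 101/110; nothing of the sources asserted)] -/
theorem F_N {a : ℕ} (ha1 : 1 ≤ a) (ha9 : a ≤ 9) (i : Fin 3) : F k (N k a i) = nv k a i := by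
  have h := congrFun (F₀_pc k ha1 ha9) i
  rw [Function.comp_apply] at h
  rw [N, map_mul, F_algebraMap, h, ← mul_assoc, mul_comm (F k (cB k a)), F_cB_mul, one_mul]

/-! ## The two composites and the isomorphism -/

/-- **`F ∘ G = id` on `Rh ⧸ J`.**
[cite: Hu2025, Thm. 9.4 («U is isomorphic to the quotient space Gr̄_d») p.161; joint J1 = GAP-LEDGER-HU row HU-R01 (unrefereed preprints under adjudication, D-0012/D-0089 — kernel support on OUR typed carriers of rows 101/110; nothing of the sources asserted)] -/
theorem F_comp_G : (F k).comp (G k) = RingHom.id (Slice k) := by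
  apply Ideal.Quotient.ringHom_ext
  rw [RingHom.comp_assoc, G, Ideal.Quotient.lift_comp_mk, RingHom.id_comp]
  apply IsLocalization.ringHom_ext (Submonoid.powers (hq k))
  apply Ideal.Quotient.ringHom_ext
  refine MvPolynomial.ringHom_ext (fun c => ?_) (fun x => ?_)
  · simp only [RingHom.comp_apply]
    have h1 := ΦGh_toRh_C k c
    rw [toRh, RingHom.comp_apply] at h1
    rw [h1, F_algebraMap, ← MvPolynomial.algebraMap_eq, AlgHom.commutes]
    rfl
  · simp only [RingHom.comp_apply]
    obtain ⟨t, ht⟩ := x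
    have hidx := mem_plIndexSet_iff.mp (Finset.mem_erase.mp ht).2
    have e : (X ⟨t, ht⟩ : ChartRing 9 k) = xbar k t := (xbar_of_mem k ht).symm
    have hm : (algebraMap (Rq k) (Rh k)) (Ideal.Quotient.mk (gammaChartIdeal k 9 quadGamma) (X ⟨t, ht⟩)) = m k t := by
      rw [e]; rfl
    rw [hm, ΦGh_m k ht, map_det3]
    have e1 : (F k) ∘ N k t.1 = nv k t.1 := funext fun i => F_N k (by omega) (by omega) i
    have e2 : (F k) ∘ N k t.2.1 = nv k t.2.1 := funext fun i => F_N k (by omega) (by omega) i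
    have e3 : (F k) ∘ N k t.2.2 = nv k t.2.2 := funext fun i => F_N k (by omega) (by omega) i
    rw [e1, e2, e3, ← ms_eq_det3 k ht]
    rfl

/-- **`G ∘ F = id` on `B6`.**
[cite: Hu2025, Thm. 9.4 («U is isomorphic to the quotient space Gr̄_d») p.161; joint J1 = GAP-LEDGER-HU row HU-R01 (unrefereed preprints under adjudication, D-0012/D-0089 — kernel support on OUR typed carriers of rows 101/110; nothing of the sources asserted)] -/
theorem G_comp_F : (G k).comp (F k) = RingHom.id (B6 k) := by
  obtain ⟨-, -, -, -, c5, c6, c7, c8, -⟩ := pc_val k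
  obtain ⟨x0, x1, x2, x3, x4, x5⟩ := F₀_X k
  have e5 := cB_eq_one k (a := 5) (by norm_num) (by norm_num) (by norm_num)
  have e7 := cB_eq_one k (a := 7) (by norm_num) (by norm_num) (by norm_num)
  obtain ⟨v6, v8, -, -⟩ := dpoly_vals k
  have d6 := dpoly_mul_cB k 6
  have d8 := dpoly_mul_cB k 8
  rw [v6] at d6
  rw [v8] at d8
  apply IsLocalization.ringHom_ext (Submonoid.powers (Δ6 k))
  refine MvPolynomial.ringHom_ext (fun c => ?_) (fun j => ?_)
  · simp only [RingHom.comp_apply, RingHom.id_apply]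
    rw [F_algebraMap, F₀, MvPolynomial.aeval_C, IsScalarTower.algebraMap_apply k (Rh k) (Slice k), ← toRh_C,
      Ideal.Quotient.algebraMap_eq, G, Ideal.Quotient.lift_mk, ΦGh_toRh_C]
  · simp only [RingHom.comp_apply, RingHom.id_apply]
    rw [F_algebraMap]
    fin_cases j
    · show G k (F₀ k (X 0)) = algebraMap (P6 k) (B6 k) (X 0)
      rw [x0, show bq k 5 = nv k 5 1 from rfl, G_nv k (by norm_num) (by norm_num), N, c5, e5, one_mul]; simp [p5]
    · show G k (F₀ k (X 1)) = algebraMap (P6 k) (B6 k) (X 1)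
      rw [x1, show cq k 5 = nv k 5 2 from rfl, G_nv k (by norm_num) (by norm_num), N, c5, e5, one_mul]; simp [p5]
    · show G k (F₀ k (X 2)) = algebraMap (P6 k) (B6 k) (X 2)
      rw [x2, show bq k 6 = nv k 6 1 from rfl, G_nv k (by norm_num) (by norm_num), N, c6]
      simp only [p6, Matrix.cons_val_one, Matrix.cons_val_zero, map_mul]
      rw [← mul_assoc, mul_comm (cB k 6), d6, one_mul]
    · show G k (F₀ k (X 3)) = algebraMap (P6 k) (B6 k) (X 3)
      rw [x3, show bq k 7 = nv k 7 1 from rfl, G_nv k (by norm_num) (by norm_num), N, c7, e7, one_mul]; simp [p7]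
    · show G k (F₀ k (X 4)) = algebraMap (P6 k) (B6 k) (X 4)
      rw [x4, show cq k 7 = nv k 7 2 from rfl, G_nv k (by norm_num) (by norm_num), N, c7, e7, one_mul]; simp [p7]
    · show G k (F₀ k (X 5)) = algebraMap (P6 k) (B6 k) (X 5)
      rw [x5, show bq k 8 = nv k 8 1 from rfl, G_nv k (by norm_num) (by norm_num), N, c8]
      simp only [p8, Matrix.cons_val_one, Matrix.cons_val_zero, map_mul]
      rw [← mul_assoc, mul_comm (cB k 8), d8, one_mul]

/-- **MAIN (W11j): `Gr̄_quad = Spec (Rh ⧸ J)` IS AN OPEN OF `𝔸⁶`** — the ring isomorphism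
`sliceRationalEquiv : Rh ⧸ J ≃+* k[y₀, …, y₅][1/Δ6]`, inverse to the evaluation at the explicit normal-form matrix `N(y)` (so the six
slice coordinates `(b₅, c₅, b₆, b₇, c₇, b₈)` are algebraically independent coordinates on the torus quotient and everything else is a
rational function of them with denominators dividing `Δ6`). This is the ring-level content of row 110 h's `r_pos` clause for `d = quad`
with `X := Spec k`, `r := 6`, `U := D(Δ6) ⊂ 𝔸⁶` (res-type-024's recipe, `SplitTorusOverAPI`). OURS; nothing of [Hu25]/[Hu22] asserted.
[cite: Hu2025, Thm. 9.4 («there exists a positive integer r and an open subset U ⊂ X × 𝔸^r … such that U is isomorphic to the quotient space Gr̄_d := Gr_d/(𝔾ⁿ_m/𝔾_m)») p.161; [Hu22] p.130 l.45–50, p.131 l.6–9; joint J1 = GAP-LEDGER-HU row HU-R01, reading (β) (unrefereed preprints under adjudication, D-0012/D-0089 — kernel support on OUR typed carriers of rows 101/110; nothing of the sources asserted)] -/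
def sliceRationalEquiv : Slice k ≃+* B6 k :=
  RingEquiv.ofRingHom (G k) (F k) (G_comp_F k) (F_comp_G k)

/-- `sliceRationalEquiv` is `G`.
[cite: Hu2025, Thm. 9.4 p.161; joint J1 = GAP-LEDGER-HU row HU-R01 (unrefereed preprints under adjudication, D-0012/D-0089 — kernel support on OUR typed carriers of rows 101/110; nothing of the sources asserted)] -/
theorem sliceRationalEquiv_apply (x : Slice k) : sliceRationalEquiv k x = G k x := rfl

end QuadTorus

end Literature.AlgebraicGeometry.Hu2025.Statements.S03Pluecker

end
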